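import Summits.KontsevichZagierPeriods.KontsevichZagierPeriods.Theorems.SoloInformedSegPiece
import Summits.KontsevichZagierPeriods.KontsevichZagierPeriods.Theorems.SoloInformedPresRat
import HarnessLib
import HarnessLib.Audit

/-!
# SoloInformed — the Kontsevich–Zagier period conjecture for rational representations of dimension ≤ 1

Solo programme `solo-KontsevichZagierPeriods-informed`, session s112 (kernel project
«`SoloInformedKZPUpTo 1` unconditionally from the tree's kernel Baker theorem»), file 10 —
the summit-directed theorem of the project:

**`soloInformed_kzpUpTo_one : SoloInformedKZPUpTo 1`.**  Any two integral representations of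
dimensions `≤ 1` with rational integrands (`P/Q`, `P, Q ∈ ℚ[x]`, on arbitrary `ℚ`-semialgebraic
domains, absolutely convergent) and the same value are equivalent under the Kontsevich–Zagier
moves (additivity, algebraic change of variables, Newton–Leibniz) — unconditionally.

Proof.  Every such representation lies in the span of points and segments
(`soloInformed_of_mem_segSpan_of_isRational`): dimension `0` directly; dimension `1` by
compactification (`KZ.exists_sub_sum_bounded_mem_relations`), cylindrical decomposition of the
bounded domain into open intervals with algebraic end points and finitely many points, and the
piece lemma of file 9 (Baker normal form ⇒ `[pt, a] + Σ Seg`).  On the span the conjecture holds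
(`soloInformed_equivalent_of_mem_segSpan`, file 7): the difference of two elements with the same
value has a normal form `[pt, a] + Σ_k Seg(g_k, c_k)` of value `a + Σ_k Re(g_k Log c_k) = 0`, which
is a relation by the null theorem (file 6) — the kernel form of Baker's theorem
(`baker_decomposition_complex`) splits the vanishing linear form in logarithms into `ℚ-linear`
dependencies among the logarithms, realised geometrically by the multiplication move
`Seg(h, a) + Seg(h, b) ≡ Seg(h, ab)` (a homotopy of paths, Green's formula on the square) after
halving into conjugate pairs.

The truncation `N = 1` of `KontsevichZagierPeriods ↔ ∀ N, SoloInformedKZPUpTo N`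
(`soloInformed_kzp_iff_forall_kzpUpTo`) is thereby a theorem of the tree; the values concerned
are exactly `ℚ̄ ∩ ℝ + Σ ℚ̄·Log ℚ̄` (real parts), the Baker periods.

References: M. Kontsevich, D. Zagier, *Periods* (2001), §1.2, Question 1; A. Baker,
*Transcendental Number Theory* (1975), Thm. 2.1; J. Ayoub, *Une version relative de la conjecture
des périodes de Kontsevich–Zagier*, Ann. Math. (2015) (the one-dimensional case is classical in
spirit; this formal, move-level version for arbitrary semialgebraic domains is this work).
-/

noncomputable section

open scoped BigOperators ComplexConjugate Polynomial
open MeasureTheory Set Filter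
open Literature.ModelTheory.ExponentialFields
open Literature.NumberTheory.Transcendental Literature.NumberTheory.Transcendental.KZ

namespace Summit.KontsevichZagierPeriods.KontsevichZagierPeriods.Theorems

/-! ### Dimension zero -/

/-- A representation of dimension `0` is a point representation or empty: it lies in the span. -/
theorem soloInformed_segSpan_of_dim_zero (r : IntegralRep 0) : of r ∈ soloInformedSegSpan := by
  set pt : Fin 0 → ℝ := Fin.elim0 with hpt
  have hall : ∀ x : Fin 0 → ℝ, x = pt := fun x => Subsingleton.elim _ _
  by_cases hmem : pt ∈ r.domain
  · have hdom : r.domain = univ := eq_univ_of_forall fun x => (hall x).symm ▸ hmem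
    have halg : IsAlgebraic ℚ (r.integrand pt) :=
      r.isSemialgebraicFunOn_integrand.isAlgebraic_apply hmem fun i => i.elim0
    refine soloInformed_mem_segSpan_of_sub_mem ?_ (soloInformed_ptRep_mem_segSpan _ halg)
    refine of_sub_of_mem_relations_of_eqOn (by rw [soloInformed_ptRep_domain, hdom]) fun x _ => ?_
    rw [soloInformed_ptRep_integrand, hall x]
  · have hdom : r.domain = ∅ := Set.eq_empty_of_subset_empty fun x hx => hmem ((hall x) ▸ hx)
    refine soloInformed_relations_le_segSpan (of_mem_relations_of_eqOn_zero r fun x hx => ?_)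
    rw [hdom] at hx
    exact hx.elim

/-! ### Dimension one -/

/-- **Bounded domains.** A rational representation of dimension one with bounded domain lies in
the span of points and segments: cylindrical decomposition of the domain into open intervals with
algebraic end points and finitely many points (rule (1)), and the piece lemma on each interval.
[Basu–Pollack–Roy 2006, Cor. 5.7; this work] -/
theorem soloInformed_segSpan_of_isRational_isBounded_one (r : IntegralRep 1)
    (hr : r.IsRational) (hb : Bornology.IsBounded r.domain) :
    of r ∈ soloInformedSegSpan := by
  classical
  obtain ⟨p, q, hq, hpq⟩ := hr
  -- univariate reading of the integrand
  have hconv : ∀ f : MvPolynomial (Fin 1) ℚ, ∃ F : ℚ[X], ∀ x : Fin 1 → ℝ,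
      MvPolynomial.aeval x f = Polynomial.aeval (x 0) F := fun f => by
    refine ⟨MvPolynomial.aeval (fun _ : Fin 1 => (Polynomial.X : ℚ[X])) f, fun x => ?_⟩
    have hx : x = fun _ => x 0 := KZ.eq_const_apply_zero x
    conv_lhs => rw [hx]
    rw [← AlgHom.comp_apply, MvPolynomial.comp_aeval]
    simp
  obtain ⟨P, hP⟩ := hconv p
  obtain ⟨Q, hQ⟩ := hconv q
  have hq' : ∀ x ∈ r.domain, (Polynomial.aeval (x 0) Q : ℝ) ≠ 0 := fun x hx h =>
    hq x hx ((hQ x).trans h)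
  have hpq' : EqOn r.integrand
      (fun x => (Polynomial.aeval (x 0) P : ℝ) / Polynomial.aeval (x 0) Q) r.domain :=
    fun x hx => by
      rw [hpq hx]
      show MvPolynomial.aeval x p / MvPolynomial.aeval x q = _
      rw [hP x, hQ x]
  -- an adapted cylindrical decomposition of the line
  obtain ⟨𝒮, hcd, hF⟩ := IsSemialgebraic.exists_cylindricalDecomposition_holds (k := ℚ)
    ({r.domain} : Finset (Set (Fin 1 → ℝ))) (by simpa using r.isSemialgebraic_domain)
  obtain ⟨𝒞, h𝒞𝒮, h𝒞K⟩ := hF r.domain (by simp)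
  obtain ⟨-, hsemi, 𝒮₀, h0, hstack⟩ := isCylindricalDecomposition_succ.1 hcd
  have h0' : 𝒮₀ = {univ} := isCylindricalDecomposition_zero.1 h0
  subst h0'
  obtain ⟨l, ξ, -, hsa, hmono, hcells⟩ := hstack
  -- the sections over the point and their values
  set pt : Fin 0 → ℝ := Fin.elim0 with hpt
  set L := l univ with hL
  set ζ : Fin L → (Fin 0 → ℝ) → ℝ := ξ univ with hζ
  set c : Fin L → ℝ := fun j => ζ j pt with hc
  have hcmono : StrictMono c := hmono univ (by simp) pt (mem_univ _)
  have hinit : ∀ w : Fin 1 → ℝ, Fin.init w = pt := fun w => Subsingleton.elim _ _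
  -- the graph cells are the points `c j`, which are therefore algebraic
  have hgraph : ∀ j : Fin L, graphOver univ (ζ j) = {fun _ => c j} := fun j => by
    ext w
    rw [mem_graphOver_iff, hinit w, mem_singleton_iff]
    simp only [mem_univ, true_and]
    constructor
    · intro h; rw [KZ.eq_const_apply_zero w]; exact congrArg (fun t => fun _ : Fin 1 => t) h
    · intro h; rw [h]
  have halg : ∀ j : Fin L, IsAlgebraic ℚ (c j) := fun j => by
    have hmem : graphOver univ (ζ j) ∈ 𝒮 := (hcells _).2 ⟨univ, by simp, Or.inl ⟨j, rfl⟩⟩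
    have hs := hsemi _ hmem
    rw [hgraph j] at hs
    exact isAlgebraic_of_mem_of_finite hs (finite_singleton _) (mem_singleton _)
  -- the index set: bands contained in the (bounded) domain; they are interior bands
  let ι := {j : Fin (L + 1) // bandOver univ ζ j ∈ 𝒞}
  have hsubD : ∀ i : ι, bandOver univ ζ i.1 ⊆ r.domain := fun i =>
    h𝒞K ▸ subset_sUnion_of_mem i.2
  have hne0 : ∀ i : ι, i.1 ≠ 0 := fun i h =>
    soloInformed_band_zero_not_isBounded ζ (hb.subset (h ▸ hsubD i))
  have hnel : ∀ i : ι, i.1 ≠ Fin.last L := fun i h =>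
    soloInformed_band_last_not_isBounded ζ (hb.subset (h ▸ hsubD i))
  set lo : ι → ℝ := fun i => c (i.1.pred (hne0 i)) with hlo
  set hi : ι → ℝ := fun i => c (i.1.castPred (hnel i)) with hhi
  have hlohi : ∀ i, lo i < hi i := fun i => hcmono (by
    rw [Fin.lt_def, Fin.val_pred, Fin.coe_castPred]
    have h1 : (i.1 : ℕ) ≠ 0 := fun h => hne0 i (Fin.ext h)
    omega)
  have hband : ∀ i : ι, bandOver univ ζ i.1 = {w | ∀ k, lo i < w k ∧ w k < hi i} := fun i => by
    ext w
    rw [mem_bandOver_iff, bandLower_of_ne_zero ζ i.1 (hne0 i), bandUpper_of_ne_last ζ i.1 (hnel i),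
      hinit w, EReal.coe_lt_coe_iff, EReal.coe_lt_coe_iff]
    simp only [mem_univ, true_and, mem_setOf_eq]
    constructor
    · rintro h ⟨k, hk⟩
      have hk0 : k = 0 := by omega
      subst hk0
      exact h
    · intro h
      exact h (Fin.last 0)
  have hbandS : ∀ i : ι, IsSemialgebraic ℚ {w : Fin 1 → ℝ | ∀ k, lo i < w k ∧ w k < hi i} :=
    fun i => hband i ▸ hsemi _ (h𝒞𝒮 i.2)
  have hbandD : ∀ i : ι, {w : Fin 1 → ℝ | ∀ k, lo i < w k ∧ w k < hi i} ⊆ r.domain :=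
    fun i => hband i ▸ hsubD i
  -- the pieces
  set R : ι → IntegralRep 1 := fun i => r.restrict _ (hbandS i) (hbandD i) with hR
  have hpieces : ∀ i, of (R i) ∈ soloInformedSegSpan := fun i =>
    soloInformed_restrict_interval_mem_segSpan r hq' hpq' (hlohi i) (halg _) (halg _) (hbandS i)
      (hbandD i)
  -- rule (1) over the almost-partition of the domain by the bands
  have hpart : of r - ∑ i, of (R i) ∈ relations := by
    refine KZ.of_sub_sum_of_mem_relations Finset.univ r R (fun i _ => ?_) (fun i _ _ _ => rfl)
      ?_ ?_
    · rw [show (R i).domain \ r.domain = ∅ from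
        Set.eq_empty_of_subset_empty fun w hw => hw.2 (hbandD i hw.1), measure_empty]
    · -- the uncovered part of the domain consists of graph cells: finitely many points
      refine measure_mono_null (fun w hw => ?_)
        ((Set.finite_range fun j : Fin L => (fun _ => c j : Fin 1 → ℝ)).measure_zero volume)
      obtain ⟨hwD, hwU⟩ := hw
      have hwD' : w ∈ ⋃₀ (𝒞 : Set (Set (Fin 1 → ℝ))) := by rw [h𝒞K]; exact hwD
      obtain ⟨T, hT𝒞, hwT⟩ := mem_sUnion.1 hwD'
      obtain ⟨S, hS, hT⟩ := (hcells T).1 (h𝒞𝒮 hT𝒞)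
      rw [Finset.mem_singleton] at hS
      subst hS
      rcases hT with ⟨j, rfl⟩ | ⟨j, rfl⟩
      · rw [hgraph j, mem_singleton_iff] at hwT
        exact ⟨j, hwT.symm⟩
      · refine (hwU ?_).elim
        refine mem_iUnion₂.2 ⟨⟨j, hT𝒞⟩, Finset.mem_univ _, ?_⟩
        show w ∈ {w : Fin 1 → ℝ | ∀ k, lo ⟨j, hT𝒞⟩ < w k ∧ w k < hi ⟨j, hT𝒞⟩}
        rw [← hband ⟨j, hT𝒞⟩]
        exact hwT
    · -- distinct interior bands are disjoint
      intro i _ j _ hij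
      suffices h : {w : Fin 1 → ℝ | ∀ k, lo i < w k ∧ w k < hi i} ∩
          {w | ∀ k, lo j < w k ∧ w k < hi j} = ∅ by
        show volume ({w : Fin 1 → ℝ | ∀ k, lo i < w k ∧ w k < hi i} ∩
          {w | ∀ k, lo j < w k ∧ w k < hi j}) = 0
        rw [h]; exact measure_empty
      ext w
      simp only [mem_inter_iff, mem_setOf_eq, mem_empty_iff_false, iff_false, not_and]
      intro hwi hwj
      have hij' : i.1 ≠ j.1 := fun h => hij (Subtype.ext h)
      rcases lt_or_gt_of_ne hij' with hlt | hgt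
      · have hle : hi i ≤ lo j := hcmono.monotone (by
          rw [Fin.le_def, Fin.val_pred, Fin.coe_castPred]; rw [Fin.lt_def] at hlt; omega)
        linarith [(hwi 0).2, (hwj 0).1]
      · have hle : hi j ≤ lo i := hcmono.monotone (by
          rw [Fin.le_def, Fin.val_pred, Fin.coe_castPred]; rw [Fin.lt_def] at hgt; omega)
        linarith [(hwj 0).2, (hwi 0).1]
  exact soloInformed_mem_segSpan_of_sub_mem hpart
    (soloInformed_sum_mem_segSpan _ fun i _ => hpieces i)

/-- **Every rational representation of dimension one lies in the span of points and segments**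
(compactify by the projective charts, `KZ.exists_sub_sum_bounded_mem_relations`, then the bounded
case). [this work] -/
theorem soloInformed_segSpan_of_isRational_one (r : IntegralRep 1) (hr : r.IsRational) :
    of r ∈ soloInformedSegSpan := by
  obtain ⟨R, hR, hrel⟩ := KZ.exists_sub_sum_bounded_mem_relations r hr
  exact soloInformed_mem_segSpan_of_sub_mem hrel (soloInformed_sum_mem_segSpan _ fun T _ =>
    soloInformed_segSpan_of_isRational_isBounded_one (R T) (hR T).1 (hR T).2)

/-- Rational representations of dimension `≤ 1` lie in the span of points and segments. -/
theorem soloInformed_of_mem_segSpan_of_isRational {n : ℕ} (hn : n ≤ 1) (r : IntegralRep n)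
    (hr : r.IsRational) : of r ∈ soloInformedSegSpan := by
  rcases Nat.le_one_iff_eq_zero_or_eq_one.1 hn with rfl | rfl
  · exact soloInformed_segSpan_of_dim_zero r
  · exact soloInformed_segSpan_of_isRational_one r hr

/-! ### The theorem -/

/-- **The Kontsevich–Zagier period conjecture for rational representations of dimension `≤ 1`**
(`SoloInformedKZPUpTo 1`, unconditionally): two absolutely convergent integrals
`∫_D P/Q dx` (`P, Q ∈ ℚ[x]`, `D ⊆ ℝ` `ℚ`-semialgebraic) — or rational constants over the point —
with the same value are connected by a finite chain of the three Kontsevich–Zagier moves.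
[Kontsevich–Zagier 2001, §1.2, Question 1 (dimension ≤ 1); Baker 1975, Thm. 2.1; this work] -/
theorem soloInformed_kzpUpTo_one : SoloInformedKZPUpTo 1 :=
  fun _ _ r r' hn hm hr hr' hv =>
    soloInformed_equivalent_of_mem_segSpan (soloInformed_of_mem_segSpan_of_isRational hn r hr)
      (soloInformed_of_mem_segSpan_of_isRational hm r' hr') hv

end Summit.KontsevichZagierPeriods.KontsevichZagierPeriods.Theorems
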